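import Summits.ABC.IUTFork.Conditional.AbcOfSGenuineKLinUniformRows1
import Summits.ABC.IUTFork.Conditional.AbcOfSGenuineMLinUniformHarvest1
import HarnessLib

/-!
# M LINE: R-W N3 rows DECIDED (refuted side, S_H level at the M-level sharp setting) UNCONDITIONALLY by the local-type-uniform [LIN] test — HARVEST part 7
# (2 known abc triples, 146 (triple, l) pairs of HOME/plan/rescue/R-W/TE30-CENSUS.tsv v2)

PROOF-ONLY file (no `def`, no new `Prop`, no instance) of the abc-iut cell (W6 prover seat abc-iut-w6-d108, gen 5; R-W lane P−/U row
«W:LINU-HARVEST» = abc-iut-rw-num-lead's LIN-UNIFORM HARVEST LIST, HOME/STATUS 2026-08-26T20:16:17Z: «your e-free decider p464182 fires on 1,907 of the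
2,158 Szpiro-BAD admissible (known triple, l) pairs of N3 … 1,800 MORE kernel rows available NOW by one 'exact' each — per-row (p, v, B, i₀) in
HOME/plan/rescue/R-W/TE30-CENSUS.tsv v2 4aacf04dd720d649 columns linu/linu_decidable»). TAKES NO SIDE on [IUTchIII] Cor. 3.12 or on any author.
M TWIN of this seat's K-line files `AbcOfSGenuineKLinUniformHarvest1–8` (p469692 … p469861; same tables). NO new engine: every row is ONE application of
abc-iut-w5-d107's `GenuineM.not_pilotKummerCompatHull_triple_of_linUniform` (`AbcOfSGenuineMLinUniformTriple`, p466242: abc-iut-s2-p8's M-level sharp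
setting `settingPrVolSharpM` of the datum's own read-off ideles `tqM`, pinned reading; `u` a finite place of `ℚ` with `p_u ∉ {2, 3, 5, l}`, `p_u^v ∣ abc`,
`30·l < p_u^B·(p_u−1)`, `j = i₀+1 ≤ l⋆` and the same integer test ⇒ ¬S_H at EVERY genuine Θ-volume datum over `(ratPoint (a/c), l)`), packaged through the M
table master `GenuineM.not_pilotKummerCompatHull_triple_of_linUniform_table` (M part 1): ONE theorem per (triple, pole prime `p`), hypothesis
`l ∈ [l₁, …, l_k]` = every Szpiro-bad admissible `l` of the census at which the test passes, the certificate table `(l, p, v, B, i₀)` copied from the census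
and RE-CHECKED in the kernel by `fin_cases` + `norm_num` (and at the desk by an independent third implementation, this seat's work/gen_harvest.py —
rw-num-lead's engines A/B being the first two). The abc-triple lemmas are REUSED BY NAME from abc-iut-w5-d107 / abc-iut-W-ref-2 / abc-iut-w5-d236's rows
files where they exist. Rows of this part: `frey-2^2*3^4*163^3*1006151+43^13=11^9*29^4*101^3` (73 l); `frey-2^6*5^2*7^13*13^2*463+3^4*43^12=11^12*389^2*6841` (73 l).
HONEST SCOPE as in p466242 / p464182: SHARP reading (Θ-possible-image set constant in `m`, typed (Ind1)/(Ind2) = Dupuy–Hilado families); per-label licence STRONGER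
than print; admissibility / Szpiro-badness / (P6) / non-emptiness of the datum type NOT claimed (apex assemblers' inputs, `Conditional.not_hSHwBad_of_refuted`
p465583); «refuted as typed» ≠ «refuted in print»; nothing about the number-level Corollary; typed ≠ proved; instantiated ≠ endorsed.
[cite: Mochizuki2012, IUTchIII Cor. 3.12 Step (xi-f) p. 184; IUTchIV Prop. 1.2 p. 10, Cor. 2.2 (ii) proof p. 44–46] [cite: MochizukiGenEll2010, Thm. 2.1 p. 11]
[claim: Mochizuki2012, status: disputed] for every IUT sentence quoted.
-/

noncomputable section

open Set Function NumberField IsDedekindDomain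

namespace Summit.ABC.IUTFork.Conditional

open Thm311 Thm311.Real Cor312 Cor312Vol Cor312Prov Literature.IUT.LogThetaLattice Literature.IUT.LogVolume
  Literature.IUT.HodgeTheaters Literature.IUT.LogVolume.ThetaData Literature.IUT.LogVolume.Cor22
open Literature.NumberTheory.NumberFields Literature.NumberTheory.GaloisRepresentations.Ultrametric
open Literature.NumberTheory.DiophantineGeometry Literature.NumberTheory.DiophantineGeometry.GenEll Summit.ABC.ABC.Theorems

/-! ## §1. M-line rows (one theorem per known abc triple and pole prime) -/

/-- **M LINE, R-W N3 ROWS `frey-2^2*3^4*163^3*1006151+43^13=11^9*29^4*101^3` over `p = 11` — REFUTED side, UNCONDITIONALLY, by the local-type-uniform [LIN] test at the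
71 Szpiro-bad admissible primes** `l ∈` {17, 19, 23, 29, 31, 37, 41, 47, 53, 59, 61, 67, 71, 73, 79, 83, 89, 97, 101, 103, 107, 109, 113, 127, 131, 137, 139, 149, 151, 157, 163,
167, 173, 179, 181, 191, 193, 197, 199, 211, 223, 227, 229, 233, 239, 241, 251, 257, 263, 269, 271, 277, 281, 283, 293, 307, 311, 313, 317,
331, 337, 347, 349, 353, 359, 367, 373, 379, 383, 389, 397} (rows of HOME/plan/rescue/R-W/TE30-CENSUS.tsv v2 with `linu_decidable = Y`; table rows
`(l, p, v, B, i₀)`, j = i₀+1; `p = 11`, `v = 9` (all rows)): for every finite place `u` of `ℚ` with `p_u = 11` and every genuine Θ-volume datum `T` over `(ratPoint (a/c), l)`, the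
hull-level clause S_H at the M-level sharp setting of `T`'s own read-off ideles (pinned reading) FAILS for every choice of the free context binders and Kummer
datum (M twin of the K-line `GenuineK.not_pilotKummerCompatHull_chosen_frey1411792877634228_linu`). NOT claimed: admissibility / Szpiro-badness / (P6) / non-emptiness.
[cite: Mochizuki2012, IUTchIII Cor. 3.12 Step (xi-f) p. 184] [claim: Mochizuki2012, status: disputed] -/
theorem GenuineM.not_pilotKummerCompatHull_frey1411792877634228_p11_linu {l : ℕ}
    (hl : l ∈ [17, 19, 23, 29, 31, 37, 41, 47, 53, 59, 61, 67, 71, 73, 79, 83, 89, 97, 101, 103, 107, 109, 113, 127, 131, 137, 139, 149, 151, 157, 163,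
      167, 173, 179, 181, 191, 193, 197, 199, 211, 223, 227, 229, 233, 239, 241, 251, 257, 263, 269, 271, 277, 281, 283, 293, 307, 311, 313, 317,
      331, 337, 347, 349, 353, 359, 367, 373, 379, 383, 389, 397])
    (T : Cor22.ThetaVolumeDatumAt (ratPoint (((2 ^ 2 * 3 ^ 4 * 163 ^ 3 * 1006151 : ℕ) : ℚ) / (11 ^ 9 * 29 ^ 4 * 101 ^ 3 : ℕ))) l) (u : FinitePlace ℚ) (hu : ratChar u = 11) :
    letI := T.instFieldF; letI := T.instNumberFieldF; letI := T.instAlgebraF; letI := T.instFieldK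
    letI := T.instNumberFieldK; letI := T.instAlgebraK; letI := T.instFieldFbar; letI := T.instAlgebraFbar
    letI := T.instAlgebraKFbar; letI := T.instIsElliptic
    ∀ (M : Type) [Field M] [NumberField M]
      (archPk : ∀ (j : (thetaIndexOfInitial T.D).Label) (vQ : (thetaIndexOfInitial T.D).VQ),
        Set ((logShellsOfInitialDH T.D (analyticLogvVal T.K)).Packet j vQ))
      (archSub : ∀ (j : (thetaIndexOfInitial T.D).Label) (v : (thetaIndexOfInitial T.D).V),
        Set ((logShellsOfInitialDH T.D (analyticLogvVal T.K)).Packet j ((thetaIndexOfInitial T.D).over v)))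
      (Ψ : ℤ → ∀ v : (thetaIndexOfInitial T.D).V, v ∈ (thetaIndexOfInitial T.D).Vbad →
        Set ((logShellsOfInitialDH T.D (analyticLogvVal T.K)).StarPacket v))
      (act : ℤ → ∀ v : (thetaIndexOfInitial T.D).V, v ∈ (thetaIndexOfInitial T.D).Vbad →
        (logShellsOfInitialDH T.D (analyticLogvVal T.K)).StarPacket v →
          Module.End ℚ ((logShellsOfInitialDH T.D (analyticLogvVal T.K)).StarPacket v))
      (Mmod : ℤ → ∀ j : (thetaIndexOfInitial T.D).LabelStar, Set ((logShellsOfInitialDH T.D (analyticLogvVal T.K)).GlobalPacket j.1))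
      (region : ℤ → ∀ j : (thetaIndexOfInitial T.D).LabelStar, FinDivisor M → ∀ vQ : (thetaIndexOfInitial T.D).VQ,
        Set ((logShellsOfInitialDH T.D (analyticLogvVal T.K)).Packet j.1 vQ))
      (frobAdm : ℤ → ℤ → ∀ (j : (thetaIndexOfInitial T.D).Label) (vQ : (thetaIndexOfInitial T.D).VQ),
        Set ((logShellsOfInitialDH T.D (analyticLogvVal T.K)).Packet j vQ) → Prop)
      (frobLogvol : ℤ → ℤ → ∀ (j : (thetaIndexOfInitial T.D).Label) (vQ : (thetaIndexOfInitial T.D).VQ),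
        Set ((logShellsOfInitialDH T.D (analyticLogvVal T.K)).Packet j vQ) → ℝ)
      (frobΨ : ℤ → ℤ → ∀ v : (thetaIndexOfInitial T.D).V, v ∈ (thetaIndexOfInitial T.D).Vbad →
        Set ((logShellsOfInitialDH T.D (analyticLogvVal T.K)).StarPacket v))
      (frobMmod : ℤ → ℤ → ∀ j : (thetaIndexOfInitial T.D).LabelStar, Set ((logShellsOfInitialDH T.D (analyticLogvVal T.K)).GlobalPacket j.1))
      (unitImage : ℤ → ℤ → ℕ → ∀ (j : (thetaIndexOfInitial T.D).Label) (vQ : (thetaIndexOfInitial T.D).VQ),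
        Set ((logShellsOfInitialDH T.D (analyticLogvVal T.K)).Packet j vQ))
      (ballImage : ℤ → ℤ → ∀ (j : (thetaIndexOfInitial T.D).Label) (vQ : (thetaIndexOfInitial T.D).VQ),
        Set ((logShellsOfInitialDH T.D (analyticLogvVal T.K)).Packet j vQ))
      (thetaDiv : ℤ → ℤ → LgpDivisor M (thetaIndexOfInitial T.D).lstar)
      (n : ℤ) {HT : Type} {LogLink : HT → HT → Type} {IsFull : ∀ {s t : HT}, LogLink s t → Prop}
      (lat : LGPGaussianLogThetaLattice LogLink IsFull)
      {Frd : Type} {IsoF : Frd → Frd → Type} {Ob : Frd → Type} {realify : Frd → Frd} {Strip : Type}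
      {IsoS : Strip → Strip → Type} {Mv : ∀ v : (thetaIndexOfInitial T.D).V, v ∈ (thetaIndexOfInitial T.D).Vbad → Type}
      [∀ v h, Monoid (Mv v h)]
      (sig : GlobalLGPFrobenioidSignature (thetaIndexOfInitial T.D).lstar (thetaIndexOfInitial T.D).V
        (· ∈ (thetaIndexOfInitial T.D).Vbad) Frd IsoF Ob realify Strip IsoS Mv)
      (split : SplittingMonoids Mv) {ObΔ : Type} {N : ∀ v : (thetaIndexOfInitial T.D).V, v ∈ (thetaIndexOfInitial T.D).Vbad → Type}
      [∀ v h, Monoid (N v h)] (qData : QPilotData ObΔ N)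
      (qK : ∀ v : (thetaIndexOfInitial T.D).V, v ∈ (thetaIndexOfInitial T.D).Vbad →
        Set ((logShellsOfInitialDH T.D (analyticLogvVal T.K)).StarPacket v)),
      ¬ Cor312Vol.PilotKummerCompatHull
        (LatticeSituation.ofShells (logShellsOfInitialDH T.D (analyticLogvVal T.K)) M archPk archSub
          (summandPiecesPrM T.D (logvAnalyticVal_analyticLogvVal (K := T.K))).Adm (summandPiecesPrM T.D (logvAnalyticVal_analyticLogvVal (K := T.K))).logvol Ψ act Mmod region frobAdm frobLogvol
          frobΨ frobMmod unitImage ballImage thetaDiv)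
        (settingPrVolSharpM T.D (logvAnalyticVal_analyticLogvVal (K := T.K)) (tOfIdeleData T.D (ideleDataOf T.D T.isVolumeInputOf))
          (fun u x => tqM T.D (ratChar u) u (natCast_ratChar_mem u) (ideleDataOf T.D T.isVolumeInputOf) x) M archPk archSub Ψ act Mmod region n lat sig split qData
          (fun u x => tqM_ne_zero T.D (ratChar u) u (natCast_ratChar_mem u) (ideleDataOf T.D T.isVolumeInputOf) x)
          (GenuineM.finite_ratPlaces_under_S T.D).toFinset
          (fun u x hu => norm_tqM_eq_one_of_not_mem T.D (ratChar u) u (natCast_ratChar_mem u) (ideleDataOf T.D T.isVolumeInputOf) x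
            fun hx => hu ((Set.Finite.mem_toFinset _).mpr ⟨x, hx⟩)))
        (fun _ => Cor312.Setting.qRegion
          (settingPrVolSharpM T.D (logvAnalyticVal_analyticLogvVal (K := T.K)) (tOfIdeleData T.D (ideleDataOf T.D T.isVolumeInputOf))
          (fun u x => tqM T.D (ratChar u) u (natCast_ratChar_mem u) (ideleDataOf T.D T.isVolumeInputOf) x) M archPk archSub Ψ act Mmod region n lat sig split qData
          (fun u x => tqM_ne_zero T.D (ratChar u) u (natCast_ratChar_mem u) (ideleDataOf T.D T.isVolumeInputOf) x)
          (GenuineM.finite_ratPlaces_under_S T.D).toFinset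
          (fun u x hu => norm_tqM_eq_one_of_not_mem T.D (ratChar u) u (natCast_ratChar_mem u) (ideleDataOf T.D T.isVolumeInputOf) x
            fun hx => hu ((Set.Finite.mem_toFinset _).mpr ⟨x, hx⟩)))) qK :=
  GenuineM.not_pilotKummerCompatHull_triple_of_linUniform_table isABCTriple_frey1411792877634228
    [(17, 11, 9, 2, 7), (19, 11, 9, 2, 7), (23, 11, 9, 2, 9), (29, 11, 9, 2, 11), (31, 11, 9, 2, 11), (37, 11, 9, 2, 14), (41, 11, 9, 3, 19),
      (47, 11, 9, 3, 22), (53, 11, 9, 3, 25), (59, 11, 9, 3, 28), (61, 11, 9, 3, 29), (67, 11, 9, 3, 31), (71, 11, 9, 3, 33), (73, 11, 9, 3, 34),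
      (79, 11, 9, 3, 37), (83, 11, 9, 3, 39), (89, 11, 9, 3, 41), (97, 11, 9, 3, 45), (101, 11, 9, 3, 47), (103, 11, 9, 3, 48),
      (107, 11, 9, 3, 50), (109, 11, 9, 3, 51), (113, 11, 9, 3, 52), (127, 11, 9, 3, 59), (131, 11, 9, 3, 61), (137, 11, 9, 3, 63),
      (139, 11, 9, 3, 64), (149, 11, 9, 3, 69), (151, 11, 9, 3, 70), (157, 11, 9, 3, 72), (163, 11, 9, 3, 75), (167, 11, 9, 3, 77),
      (173, 11, 9, 3, 80), (179, 11, 9, 3, 83), (181, 11, 9, 3, 83), (191, 11, 9, 3, 88), (193, 11, 9, 3, 89), (197, 11, 9, 3, 91),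
      (199, 11, 9, 3, 92), (211, 11, 9, 3, 97), (223, 11, 9, 3, 103), (227, 11, 9, 3, 104), (229, 11, 9, 3, 105), (233, 11, 9, 3, 107),
      (239, 11, 9, 3, 110), (241, 11, 9, 3, 111), (251, 11, 9, 3, 115), (257, 11, 9, 3, 118), (263, 11, 9, 3, 121), (269, 11, 9, 3, 124),
      (271, 11, 9, 3, 125), (277, 11, 9, 3, 127), (281, 11, 9, 3, 129), (283, 11, 9, 3, 130), (293, 11, 9, 3, 135), (307, 11, 9, 3, 141),
      (311, 11, 9, 3, 143), (313, 11, 9, 3, 144), (317, 11, 9, 3, 146), (331, 11, 9, 3, 152), (337, 11, 9, 3, 155), (347, 11, 9, 3, 159),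
      (349, 11, 9, 3, 160), (353, 11, 9, 3, 162), (359, 11, 9, 3, 165), (367, 11, 9, 3, 168), (373, 11, 9, 3, 171), (379, 11, 9, 3, 174),
      (383, 11, 9, 3, 176), (389, 11, 9, 3, 178), (397, 11, 9, 3, 182)]
    (by intro r hr; fin_cases hr <;> norm_num) (by simpa using hl) T u hu

/-- **M LINE, R-W N3 ROWS `frey-2^2*3^4*163^3*1006151+43^13=11^9*29^4*101^3` over `p = 43` — REFUTED side, UNCONDITIONALLY, by the local-type-uniform [LIN] test at the
2 Szpiro-bad admissible primes** `l ∈` {7, 11} (rows of HOME/plan/rescue/R-W/TE30-CENSUS.tsv v2 with `linu_decidable = Y`; table rows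
`(l, p, v, B, i₀)`, j = i₀+1; `p = 43`, `v = 13` (all rows)): for every finite place `u` of `ℚ` with `p_u = 43` and every genuine Θ-volume datum `T` over `(ratPoint (a/c), l)`, the
hull-level clause S_H at the M-level sharp setting of `T`'s own read-off ideles (pinned reading) FAILS for every choice of the free context binders and Kummer
datum (M twin of the K-line `GenuineK.not_pilotKummerCompatHull_chosen_frey1411792877634228_linu`). NOT claimed: admissibility / Szpiro-badness / (P6) / non-emptiness.
[cite: Mochizuki2012, IUTchIII Cor. 3.12 Step (xi-f) p. 184] [claim: Mochizuki2012, status: disputed] -/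
theorem GenuineM.not_pilotKummerCompatHull_frey1411792877634228_p43_linu {l : ℕ}
    (hl : l ∈ [7, 11])
    (T : Cor22.ThetaVolumeDatumAt (ratPoint (((2 ^ 2 * 3 ^ 4 * 163 ^ 3 * 1006151 : ℕ) : ℚ) / (11 ^ 9 * 29 ^ 4 * 101 ^ 3 : ℕ))) l) (u : FinitePlace ℚ) (hu : ratChar u = 43) :
    letI := T.instFieldF; letI := T.instNumberFieldF; letI := T.instAlgebraF; letI := T.instFieldK
    letI := T.instNumberFieldK; letI := T.instAlgebraK; letI := T.instFieldFbar; letI := T.instAlgebraFbar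
    letI := T.instAlgebraKFbar; letI := T.instIsElliptic
    ∀ (M : Type) [Field M] [NumberField M]
      (archPk : ∀ (j : (thetaIndexOfInitial T.D).Label) (vQ : (thetaIndexOfInitial T.D).VQ),
        Set ((logShellsOfInitialDH T.D (analyticLogvVal T.K)).Packet j vQ))
      (archSub : ∀ (j : (thetaIndexOfInitial T.D).Label) (v : (thetaIndexOfInitial T.D).V),
        Set ((logShellsOfInitialDH T.D (analyticLogvVal T.K)).Packet j ((thetaIndexOfInitial T.D).over v)))
      (Ψ : ℤ → ∀ v : (thetaIndexOfInitial T.D).V, v ∈ (thetaIndexOfInitial T.D).Vbad →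
        Set ((logShellsOfInitialDH T.D (analyticLogvVal T.K)).StarPacket v))
      (act : ℤ → ∀ v : (thetaIndexOfInitial T.D).V, v ∈ (thetaIndexOfInitial T.D).Vbad →
        (logShellsOfInitialDH T.D (analyticLogvVal T.K)).StarPacket v →
          Module.End ℚ ((logShellsOfInitialDH T.D (analyticLogvVal T.K)).StarPacket v))
      (Mmod : ℤ → ∀ j : (thetaIndexOfInitial T.D).LabelStar, Set ((logShellsOfInitialDH T.D (analyticLogvVal T.K)).GlobalPacket j.1))
      (region : ℤ → ∀ j : (thetaIndexOfInitial T.D).LabelStar, FinDivisor M → ∀ vQ : (thetaIndexOfInitial T.D).VQ,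
        Set ((logShellsOfInitialDH T.D (analyticLogvVal T.K)).Packet j.1 vQ))
      (frobAdm : ℤ → ℤ → ∀ (j : (thetaIndexOfInitial T.D).Label) (vQ : (thetaIndexOfInitial T.D).VQ),
        Set ((logShellsOfInitialDH T.D (analyticLogvVal T.K)).Packet j vQ) → Prop)
      (frobLogvol : ℤ → ℤ → ∀ (j : (thetaIndexOfInitial T.D).Label) (vQ : (thetaIndexOfInitial T.D).VQ),
        Set ((logShellsOfInitialDH T.D (analyticLogvVal T.K)).Packet j vQ) → ℝ)
      (frobΨ : ℤ → ℤ → ∀ v : (thetaIndexOfInitial T.D).V, v ∈ (thetaIndexOfInitial T.D).Vbad →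
        Set ((logShellsOfInitialDH T.D (analyticLogvVal T.K)).StarPacket v))
      (frobMmod : ℤ → ℤ → ∀ j : (thetaIndexOfInitial T.D).LabelStar, Set ((logShellsOfInitialDH T.D (analyticLogvVal T.K)).GlobalPacket j.1))
      (unitImage : ℤ → ℤ → ℕ → ∀ (j : (thetaIndexOfInitial T.D).Label) (vQ : (thetaIndexOfInitial T.D).VQ),
        Set ((logShellsOfInitialDH T.D (analyticLogvVal T.K)).Packet j vQ))
      (ballImage : ℤ → ℤ → ∀ (j : (thetaIndexOfInitial T.D).Label) (vQ : (thetaIndexOfInitial T.D).VQ),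
        Set ((logShellsOfInitialDH T.D (analyticLogvVal T.K)).Packet j vQ))
      (thetaDiv : ℤ → ℤ → LgpDivisor M (thetaIndexOfInitial T.D).lstar)
      (n : ℤ) {HT : Type} {LogLink : HT → HT → Type} {IsFull : ∀ {s t : HT}, LogLink s t → Prop}
      (lat : LGPGaussianLogThetaLattice LogLink IsFull)
      {Frd : Type} {IsoF : Frd → Frd → Type} {Ob : Frd → Type} {realify : Frd → Frd} {Strip : Type}
      {IsoS : Strip → Strip → Type} {Mv : ∀ v : (thetaIndexOfInitial T.D).V, v ∈ (thetaIndexOfInitial T.D).Vbad → Type}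
      [∀ v h, Monoid (Mv v h)]
      (sig : GlobalLGPFrobenioidSignature (thetaIndexOfInitial T.D).lstar (thetaIndexOfInitial T.D).V
        (· ∈ (thetaIndexOfInitial T.D).Vbad) Frd IsoF Ob realify Strip IsoS Mv)
      (split : SplittingMonoids Mv) {ObΔ : Type} {N : ∀ v : (thetaIndexOfInitial T.D).V, v ∈ (thetaIndexOfInitial T.D).Vbad → Type}
      [∀ v h, Monoid (N v h)] (qData : QPilotData ObΔ N)
      (qK : ∀ v : (thetaIndexOfInitial T.D).V, v ∈ (thetaIndexOfInitial T.D).Vbad →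
        Set ((logShellsOfInitialDH T.D (analyticLogvVal T.K)).StarPacket v)),
      ¬ Cor312Vol.PilotKummerCompatHull
        (LatticeSituation.ofShells (logShellsOfInitialDH T.D (analyticLogvVal T.K)) M archPk archSub
          (summandPiecesPrM T.D (logvAnalyticVal_analyticLogvVal (K := T.K))).Adm (summandPiecesPrM T.D (logvAnalyticVal_analyticLogvVal (K := T.K))).logvol Ψ act Mmod region frobAdm frobLogvol
          frobΨ frobMmod unitImage ballImage thetaDiv)
        (settingPrVolSharpM T.D (logvAnalyticVal_analyticLogvVal (K := T.K)) (tOfIdeleData T.D (ideleDataOf T.D T.isVolumeInputOf))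
          (fun u x => tqM T.D (ratChar u) u (natCast_ratChar_mem u) (ideleDataOf T.D T.isVolumeInputOf) x) M archPk archSub Ψ act Mmod region n lat sig split qData
          (fun u x => tqM_ne_zero T.D (ratChar u) u (natCast_ratChar_mem u) (ideleDataOf T.D T.isVolumeInputOf) x)
          (GenuineM.finite_ratPlaces_under_S T.D).toFinset
          (fun u x hu => norm_tqM_eq_one_of_not_mem T.D (ratChar u) u (natCast_ratChar_mem u) (ideleDataOf T.D T.isVolumeInputOf) x
            fun hx => hu ((Set.Finite.mem_toFinset _).mpr ⟨x, hx⟩)))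
        (fun _ => Cor312.Setting.qRegion
          (settingPrVolSharpM T.D (logvAnalyticVal_analyticLogvVal (K := T.K)) (tOfIdeleData T.D (ideleDataOf T.D T.isVolumeInputOf))
          (fun u x => tqM T.D (ratChar u) u (natCast_ratChar_mem u) (ideleDataOf T.D T.isVolumeInputOf) x) M archPk archSub Ψ act Mmod region n lat sig split qData
          (fun u x => tqM_ne_zero T.D (ratChar u) u (natCast_ratChar_mem u) (ideleDataOf T.D T.isVolumeInputOf) x)
          (GenuineM.finite_ratPlaces_under_S T.D).toFinset
          (fun u x hu => norm_tqM_eq_one_of_not_mem T.D (ratChar u) u (natCast_ratChar_mem u) (ideleDataOf T.D T.isVolumeInputOf) x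
            fun hx => hu ((Set.Finite.mem_toFinset _).mpr ⟨x, hx⟩)))) qK :=
  GenuineM.not_pilotKummerCompatHull_triple_of_linUniform_table isABCTriple_frey1411792877634228
    [(7, 43, 13, 1, 2), (11, 43, 13, 1, 2)]
    (by intro r hr; fin_cases hr <;> norm_num) (by simpa using hl) T u hu

/-- **M LINE, R-W N3 ROWS `frey-2^6*5^2*7^13*13^2*463+3^4*43^12=11^12*389^2*6841` over `p = 7` — REFUTED side, UNCONDITIONALLY, by the local-type-uniform [LIN] test at the
72 Szpiro-bad admissible primes** `l ∈` {11, 17, 19, 23, 29, 31, 37, 41, 47, 53, 59, 61, 67, 71, 73, 79, 83, 89, 97, 101, 103, 107, 109, 113, 127, 131, 137, 139, 149, 151, 157,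
163, 167, 173, 179, 181, 191, 193, 197, 199, 211, 223, 227, 229, 233, 239, 241, 251, 257, 263, 269, 271, 277, 281, 283, 293, 307, 311, 313,
317, 331, 337, 347, 349, 353, 359, 367, 373, 379, 383, 389, 397} (rows of HOME/plan/rescue/R-W/TE30-CENSUS.tsv v2 with `linu_decidable = Y`; table rows
`(l, p, v, B, i₀)`, j = i₀+1; `p = 7`, `v = 13` (all rows)): for every finite place `u` of `ℚ` with `p_u = 7` and every genuine Θ-volume datum `T` over `(ratPoint (a/c), l)`, the
hull-level clause S_H at the M-level sharp setting of `T`'s own read-off ideles (pinned reading) FAILS for every choice of the free context binders and Kummer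
datum (M twin of the K-line `GenuineK.not_pilotKummerCompatHull_chosen_frey12130039035706446400_linu`). NOT claimed: admissibility / Szpiro-badness / (P6) / non-emptiness.
[cite: Mochizuki2012, IUTchIII Cor. 3.12 Step (xi-f) p. 184] [claim: Mochizuki2012, status: disputed] -/
theorem GenuineM.not_pilotKummerCompatHull_frey12130039035706446400_p7_linu {l : ℕ}
    (hl : l ∈ [11, 17, 19, 23, 29, 31, 37, 41, 47, 53, 59, 61, 67, 71, 73, 79, 83, 89, 97, 101, 103, 107, 109, 113, 127, 131, 137, 139, 149, 151, 157,
      163, 167, 173, 179, 181, 191, 193, 197, 199, 211, 223, 227, 229, 233, 239, 241, 251, 257, 263, 269, 271, 277, 281, 283, 293, 307, 311, 313,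
      317, 331, 337, 347, 349, 353, 359, 367, 373, 379, 383, 389, 397])
    (T : Cor22.ThetaVolumeDatumAt (ratPoint (((2 ^ 6 * 5 ^ 2 * 7 ^ 13 * 13 ^ 2 * 463 : ℕ) : ℚ) / (11 ^ 12 * 389 ^ 2 * 6841 : ℕ))) l) (u : FinitePlace ℚ) (hu : ratChar u = 7) :
    letI := T.instFieldF; letI := T.instNumberFieldF; letI := T.instAlgebraF; letI := T.instFieldK
    letI := T.instNumberFieldK; letI := T.instAlgebraK; letI := T.instFieldFbar; letI := T.instAlgebraFbar
    letI := T.instAlgebraKFbar; letI := T.instIsElliptic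
    ∀ (M : Type) [Field M] [NumberField M]
      (archPk : ∀ (j : (thetaIndexOfInitial T.D).Label) (vQ : (thetaIndexOfInitial T.D).VQ),
        Set ((logShellsOfInitialDH T.D (analyticLogvVal T.K)).Packet j vQ))
      (archSub : ∀ (j : (thetaIndexOfInitial T.D).Label) (v : (thetaIndexOfInitial T.D).V),
        Set ((logShellsOfInitialDH T.D (analyticLogvVal T.K)).Packet j ((thetaIndexOfInitial T.D).over v)))
      (Ψ : ℤ → ∀ v : (thetaIndexOfInitial T.D).V, v ∈ (thetaIndexOfInitial T.D).Vbad →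
        Set ((logShellsOfInitialDH T.D (analyticLogvVal T.K)).StarPacket v))
      (act : ℤ → ∀ v : (thetaIndexOfInitial T.D).V, v ∈ (thetaIndexOfInitial T.D).Vbad →
        (logShellsOfInitialDH T.D (analyticLogvVal T.K)).StarPacket v →
          Module.End ℚ ((logShellsOfInitialDH T.D (analyticLogvVal T.K)).StarPacket v))
      (Mmod : ℤ → ∀ j : (thetaIndexOfInitial T.D).LabelStar, Set ((logShellsOfInitialDH T.D (analyticLogvVal T.K)).GlobalPacket j.1))
      (region : ℤ → ∀ j : (thetaIndexOfInitial T.D).LabelStar, FinDivisor M → ∀ vQ : (thetaIndexOfInitial T.D).VQ,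
        Set ((logShellsOfInitialDH T.D (analyticLogvVal T.K)).Packet j.1 vQ))
      (frobAdm : ℤ → ℤ → ∀ (j : (thetaIndexOfInitial T.D).Label) (vQ : (thetaIndexOfInitial T.D).VQ),
        Set ((logShellsOfInitialDH T.D (analyticLogvVal T.K)).Packet j vQ) → Prop)
      (frobLogvol : ℤ → ℤ → ∀ (j : (thetaIndexOfInitial T.D).Label) (vQ : (thetaIndexOfInitial T.D).VQ),
        Set ((logShellsOfInitialDH T.D (analyticLogvVal T.K)).Packet j vQ) → ℝ)
      (frobΨ : ℤ → ℤ → ∀ v : (thetaIndexOfInitial T.D).V, v ∈ (thetaIndexOfInitial T.D).Vbad →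
        Set ((logShellsOfInitialDH T.D (analyticLogvVal T.K)).StarPacket v))
      (frobMmod : ℤ → ℤ → ∀ j : (thetaIndexOfInitial T.D).LabelStar, Set ((logShellsOfInitialDH T.D (analyticLogvVal T.K)).GlobalPacket j.1))
      (unitImage : ℤ → ℤ → ℕ → ∀ (j : (thetaIndexOfInitial T.D).Label) (vQ : (thetaIndexOfInitial T.D).VQ),
        Set ((logShellsOfInitialDH T.D (analyticLogvVal T.K)).Packet j vQ))
      (ballImage : ℤ → ℤ → ∀ (j : (thetaIndexOfInitial T.D).Label) (vQ : (thetaIndexOfInitial T.D).VQ),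
        Set ((logShellsOfInitialDH T.D (analyticLogvVal T.K)).Packet j vQ))
      (thetaDiv : ℤ → ℤ → LgpDivisor M (thetaIndexOfInitial T.D).lstar)
      (n : ℤ) {HT : Type} {LogLink : HT → HT → Type} {IsFull : ∀ {s t : HT}, LogLink s t → Prop}
      (lat : LGPGaussianLogThetaLattice LogLink IsFull)
      {Frd : Type} {IsoF : Frd → Frd → Type} {Ob : Frd → Type} {realify : Frd → Frd} {Strip : Type}
      {IsoS : Strip → Strip → Type} {Mv : ∀ v : (thetaIndexOfInitial T.D).V, v ∈ (thetaIndexOfInitial T.D).Vbad → Type}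
      [∀ v h, Monoid (Mv v h)]
      (sig : GlobalLGPFrobenioidSignature (thetaIndexOfInitial T.D).lstar (thetaIndexOfInitial T.D).V
        (· ∈ (thetaIndexOfInitial T.D).Vbad) Frd IsoF Ob realify Strip IsoS Mv)
      (split : SplittingMonoids Mv) {ObΔ : Type} {N : ∀ v : (thetaIndexOfInitial T.D).V, v ∈ (thetaIndexOfInitial T.D).Vbad → Type}
      [∀ v h, Monoid (N v h)] (qData : QPilotData ObΔ N)
      (qK : ∀ v : (thetaIndexOfInitial T.D).V, v ∈ (thetaIndexOfInitial T.D).Vbad →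
        Set ((logShellsOfInitialDH T.D (analyticLogvVal T.K)).StarPacket v)),
      ¬ Cor312Vol.PilotKummerCompatHull
        (LatticeSituation.ofShells (logShellsOfInitialDH T.D (analyticLogvVal T.K)) M archPk archSub
          (summandPiecesPrM T.D (logvAnalyticVal_analyticLogvVal (K := T.K))).Adm (summandPiecesPrM T.D (logvAnalyticVal_analyticLogvVal (K := T.K))).logvol Ψ act Mmod region frobAdm frobLogvol
          frobΨ frobMmod unitImage ballImage thetaDiv)
        (settingPrVolSharpM T.D (logvAnalyticVal_analyticLogvVal (K := T.K)) (tOfIdeleData T.D (ideleDataOf T.D T.isVolumeInputOf))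
          (fun u x => tqM T.D (ratChar u) u (natCast_ratChar_mem u) (ideleDataOf T.D T.isVolumeInputOf) x) M archPk archSub Ψ act Mmod region n lat sig split qData
          (fun u x => tqM_ne_zero T.D (ratChar u) u (natCast_ratChar_mem u) (ideleDataOf T.D T.isVolumeInputOf) x)
          (GenuineM.finite_ratPlaces_under_S T.D).toFinset
          (fun u x hu => norm_tqM_eq_one_of_not_mem T.D (ratChar u) u (natCast_ratChar_mem u) (ideleDataOf T.D T.isVolumeInputOf) x
            fun hx => hu ((Set.Finite.mem_toFinset _).mpr ⟨x, hx⟩)))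
        (fun _ => Cor312.Setting.qRegion
          (settingPrVolSharpM T.D (logvAnalyticVal_analyticLogvVal (K := T.K)) (tOfIdeleData T.D (ideleDataOf T.D T.isVolumeInputOf))
          (fun u x => tqM T.D (ratChar u) u (natCast_ratChar_mem u) (ideleDataOf T.D T.isVolumeInputOf) x) M archPk archSub Ψ act Mmod region n lat sig split qData
          (fun u x => tqM_ne_zero T.D (ratChar u) u (natCast_ratChar_mem u) (ideleDataOf T.D T.isVolumeInputOf) x)
          (GenuineM.finite_ratPlaces_under_S T.D).toFinset
          (fun u x hu => norm_tqM_eq_one_of_not_mem T.D (ratChar u) u (natCast_ratChar_mem u) (ideleDataOf T.D T.isVolumeInputOf) x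
            fun hx => hu ((Set.Finite.mem_toFinset _).mpr ⟨x, hx⟩)))) qK :=
  GenuineM.not_pilotKummerCompatHull_triple_of_linUniform_table isABCTriple_frey12130039035706446400
    [(11, 7, 13, 3, 4), (17, 7, 13, 3, 6), (19, 7, 13, 3, 7), (23, 7, 13, 3, 8), (29, 7, 13, 3, 10), (31, 7, 13, 3, 11), (37, 7, 13, 3, 13),
      (41, 7, 13, 3, 14), (47, 7, 13, 3, 16), (53, 7, 13, 3, 18), (59, 7, 13, 3, 20), (61, 7, 13, 3, 20), (67, 7, 13, 3, 22), (71, 7, 13, 4, 29),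
      (73, 7, 13, 4, 30), (79, 7, 13, 4, 32), (83, 7, 13, 4, 34), (89, 7, 13, 4, 36), (97, 7, 13, 4, 39), (101, 7, 13, 4, 41), (103, 7, 13, 4, 42),
      (107, 7, 13, 4, 43), (109, 7, 13, 4, 44), (113, 7, 13, 4, 46), (127, 7, 13, 4, 51), (131, 7, 13, 4, 53), (137, 7, 13, 4, 55),
      (139, 7, 13, 4, 56), (149, 7, 13, 4, 60), (151, 7, 13, 4, 61), (157, 7, 13, 4, 63), (163, 7, 13, 4, 66), (167, 7, 13, 4, 67),
      (173, 7, 13, 4, 70), (179, 7, 13, 4, 72), (181, 7, 13, 4, 73), (191, 7, 13, 4, 77), (193, 7, 13, 4, 78), (197, 7, 13, 4, 79),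
      (199, 7, 13, 4, 80), (211, 7, 13, 4, 85), (223, 7, 13, 4, 90), (227, 7, 13, 4, 91), (229, 7, 13, 4, 92), (233, 7, 13, 4, 94),
      (239, 7, 13, 4, 96), (241, 7, 13, 4, 97), (251, 7, 13, 4, 101), (257, 7, 13, 4, 103), (263, 7, 13, 4, 106), (269, 7, 13, 4, 108),
      (271, 7, 13, 4, 109), (277, 7, 13, 4, 111), (281, 7, 13, 4, 113), (283, 7, 13, 4, 114), (293, 7, 13, 4, 118), (307, 7, 13, 4, 123),
      (311, 7, 13, 4, 125), (313, 7, 13, 4, 126), (317, 7, 13, 4, 127), (331, 7, 13, 4, 133), (337, 7, 13, 4, 135), (347, 7, 13, 4, 139),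
      (349, 7, 13, 4, 140), (353, 7, 13, 4, 142), (359, 7, 13, 4, 144), (367, 7, 13, 4, 147), (373, 7, 13, 4, 150), (379, 7, 13, 4, 152),
      (383, 7, 13, 4, 154), (389, 7, 13, 4, 156), (397, 7, 13, 4, 159)]
    (by intro r hr; fin_cases hr <;> norm_num) (by simpa using hl) T u hu

/-- **M LINE, R-W N3 ROWS `frey-2^6*5^2*7^13*13^2*463+3^4*43^12=11^12*389^2*6841` over `p = 11` — REFUTED side, UNCONDITIONALLY, by the local-type-uniform [LIN] test at the
1 Szpiro-bad admissible primes** `l ∈` {7} (rows of HOME/plan/rescue/R-W/TE30-CENSUS.tsv v2 with `linu_decidable = Y`; table rows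
`(l, p, v, B, i₀)`, j = i₀+1; `p = 11`, `v = 12` (all rows)): for every finite place `u` of `ℚ` with `p_u = 11` and every genuine Θ-volume datum `T` over `(ratPoint (a/c), l)`, the
hull-level clause S_H at the M-level sharp setting of `T`'s own read-off ideles (pinned reading) FAILS for every choice of the free context binders and Kummer
datum (M twin of the K-line `GenuineK.not_pilotKummerCompatHull_chosen_frey12130039035706446400_linu`). NOT claimed: admissibility / Szpiro-badness / (P6) / non-emptiness.
[cite: Mochizuki2012, IUTchIII Cor. 3.12 Step (xi-f) p. 184] [claim: Mochizuki2012, status: disputed] -/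
theorem GenuineM.not_pilotKummerCompatHull_frey12130039035706446400_p11_linu {l : ℕ}
    (hl : l ∈ [7])
    (T : Cor22.ThetaVolumeDatumAt (ratPoint (((2 ^ 6 * 5 ^ 2 * 7 ^ 13 * 13 ^ 2 * 463 : ℕ) : ℚ) / (11 ^ 12 * 389 ^ 2 * 6841 : ℕ))) l) (u : FinitePlace ℚ) (hu : ratChar u = 11) :
    letI := T.instFieldF; letI := T.instNumberFieldF; letI := T.instAlgebraF; letI := T.instFieldK
    letI := T.instNumberFieldK; letI := T.instAlgebraK; letI := T.instFieldFbar; letI := T.instAlgebraFbar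
    letI := T.instAlgebraKFbar; letI := T.instIsElliptic
    ∀ (M : Type) [Field M] [NumberField M]
      (archPk : ∀ (j : (thetaIndexOfInitial T.D).Label) (vQ : (thetaIndexOfInitial T.D).VQ),
        Set ((logShellsOfInitialDH T.D (analyticLogvVal T.K)).Packet j vQ))
      (archSub : ∀ (j : (thetaIndexOfInitial T.D).Label) (v : (thetaIndexOfInitial T.D).V),
        Set ((logShellsOfInitialDH T.D (analyticLogvVal T.K)).Packet j ((thetaIndexOfInitial T.D).over v)))
      (Ψ : ℤ → ∀ v : (thetaIndexOfInitial T.D).V, v ∈ (thetaIndexOfInitial T.D).Vbad →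
        Set ((logShellsOfInitialDH T.D (analyticLogvVal T.K)).StarPacket v))
      (act : ℤ → ∀ v : (thetaIndexOfInitial T.D).V, v ∈ (thetaIndexOfInitial T.D).Vbad →
        (logShellsOfInitialDH T.D (analyticLogvVal T.K)).StarPacket v →
          Module.End ℚ ((logShellsOfInitialDH T.D (analyticLogvVal T.K)).StarPacket v))
      (Mmod : ℤ → ∀ j : (thetaIndexOfInitial T.D).LabelStar, Set ((logShellsOfInitialDH T.D (analyticLogvVal T.K)).GlobalPacket j.1))
      (region : ℤ → ∀ j : (thetaIndexOfInitial T.D).LabelStar, FinDivisor M → ∀ vQ : (thetaIndexOfInitial T.D).VQ,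
        Set ((logShellsOfInitialDH T.D (analyticLogvVal T.K)).Packet j.1 vQ))
      (frobAdm : ℤ → ℤ → ∀ (j : (thetaIndexOfInitial T.D).Label) (vQ : (thetaIndexOfInitial T.D).VQ),
        Set ((logShellsOfInitialDH T.D (analyticLogvVal T.K)).Packet j vQ) → Prop)
      (frobLogvol : ℤ → ℤ → ∀ (j : (thetaIndexOfInitial T.D).Label) (vQ : (thetaIndexOfInitial T.D).VQ),
        Set ((logShellsOfInitialDH T.D (analyticLogvVal T.K)).Packet j vQ) → ℝ)
      (frobΨ : ℤ → ℤ → ∀ v : (thetaIndexOfInitial T.D).V, v ∈ (thetaIndexOfInitial T.D).Vbad →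
        Set ((logShellsOfInitialDH T.D (analyticLogvVal T.K)).StarPacket v))
      (frobMmod : ℤ → ℤ → ∀ j : (thetaIndexOfInitial T.D).LabelStar, Set ((logShellsOfInitialDH T.D (analyticLogvVal T.K)).GlobalPacket j.1))
      (unitImage : ℤ → ℤ → ℕ → ∀ (j : (thetaIndexOfInitial T.D).Label) (vQ : (thetaIndexOfInitial T.D).VQ),
        Set ((logShellsOfInitialDH T.D (analyticLogvVal T.K)).Packet j vQ))
      (ballImage : ℤ → ℤ → ∀ (j : (thetaIndexOfInitial T.D).Label) (vQ : (thetaIndexOfInitial T.D).VQ),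
        Set ((logShellsOfInitialDH T.D (analyticLogvVal T.K)).Packet j vQ))
      (thetaDiv : ℤ → ℤ → LgpDivisor M (thetaIndexOfInitial T.D).lstar)
      (n : ℤ) {HT : Type} {LogLink : HT → HT → Type} {IsFull : ∀ {s t : HT}, LogLink s t → Prop}
      (lat : LGPGaussianLogThetaLattice LogLink IsFull)
      {Frd : Type} {IsoF : Frd → Frd → Type} {Ob : Frd → Type} {realify : Frd → Frd} {Strip : Type}
      {IsoS : Strip → Strip → Type} {Mv : ∀ v : (thetaIndexOfInitial T.D).V, v ∈ (thetaIndexOfInitial T.D).Vbad → Type}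
      [∀ v h, Monoid (Mv v h)]
      (sig : GlobalLGPFrobenioidSignature (thetaIndexOfInitial T.D).lstar (thetaIndexOfInitial T.D).V
        (· ∈ (thetaIndexOfInitial T.D).Vbad) Frd IsoF Ob realify Strip IsoS Mv)
      (split : SplittingMonoids Mv) {ObΔ : Type} {N : ∀ v : (thetaIndexOfInitial T.D).V, v ∈ (thetaIndexOfInitial T.D).Vbad → Type}
      [∀ v h, Monoid (N v h)] (qData : QPilotData ObΔ N)
      (qK : ∀ v : (thetaIndexOfInitial T.D).V, v ∈ (thetaIndexOfInitial T.D).Vbad →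
        Set ((logShellsOfInitialDH T.D (analyticLogvVal T.K)).StarPacket v)),
      ¬ Cor312Vol.PilotKummerCompatHull
        (LatticeSituation.ofShells (logShellsOfInitialDH T.D (analyticLogvVal T.K)) M archPk archSub
          (summandPiecesPrM T.D (logvAnalyticVal_analyticLogvVal (K := T.K))).Adm (summandPiecesPrM T.D (logvAnalyticVal_analyticLogvVal (K := T.K))).logvol Ψ act Mmod region frobAdm frobLogvol
          frobΨ frobMmod unitImage ballImage thetaDiv)
        (settingPrVolSharpM T.D (logvAnalyticVal_analyticLogvVal (K := T.K)) (tOfIdeleData T.D (ideleDataOf T.D T.isVolumeInputOf))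
          (fun u x => tqM T.D (ratChar u) u (natCast_ratChar_mem u) (ideleDataOf T.D T.isVolumeInputOf) x) M archPk archSub Ψ act Mmod region n lat sig split qData
          (fun u x => tqM_ne_zero T.D (ratChar u) u (natCast_ratChar_mem u) (ideleDataOf T.D T.isVolumeInputOf) x)
          (GenuineM.finite_ratPlaces_under_S T.D).toFinset
          (fun u x hu => norm_tqM_eq_one_of_not_mem T.D (ratChar u) u (natCast_ratChar_mem u) (ideleDataOf T.D T.isVolumeInputOf) x
            fun hx => hu ((Set.Finite.mem_toFinset _).mpr ⟨x, hx⟩)))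
        (fun _ => Cor312.Setting.qRegion
          (settingPrVolSharpM T.D (logvAnalyticVal_analyticLogvVal (K := T.K)) (tOfIdeleData T.D (ideleDataOf T.D T.isVolumeInputOf))
          (fun u x => tqM T.D (ratChar u) u (natCast_ratChar_mem u) (ideleDataOf T.D T.isVolumeInputOf) x) M archPk archSub Ψ act Mmod region n lat sig split qData
          (fun u x => tqM_ne_zero T.D (ratChar u) u (natCast_ratChar_mem u) (ideleDataOf T.D T.isVolumeInputOf) x)
          (GenuineM.finite_ratPlaces_under_S T.D).toFinset
          (fun u x hu => norm_tqM_eq_one_of_not_mem T.D (ratChar u) u (natCast_ratChar_mem u) (ideleDataOf T.D T.isVolumeInputOf) x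
            fun hx => hu ((Set.Finite.mem_toFinset _).mpr ⟨x, hx⟩)))) qK :=
  GenuineM.not_pilotKummerCompatHull_triple_of_linUniform_table isABCTriple_frey12130039035706446400
    [(7, 11, 12, 2, 2)]
    (by intro r hr; fin_cases hr; norm_num) (by simpa using hl) T u hu


end Summit.ABC.IUTFork.Conditional

end
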